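import Literature.AlgebraicTopology.SingularHomology.PositiveAtlasOrientationNaturality
import Literature.AlgebraicTopology.SingularHomology.ChartTransitionLocalDegree
import Literature.AlgebraicTopology.SingularHomology.LocalDegreeSign
import HarnessLib

/-!
# Local degree `+1` at the end of an isotopy through injections, and the compatible-charts form of
# "a local homeomorphism carries the positive-atlas orientation across"

Layer `Literature/AlgebraicTopology/SingularHomology`, sub-namespace `…SingularHomology.IsotopyLocalClass`.
THEOREMS ONLY (no definition, no named fact). Pure topology (Hatcher, *Algebraic Topology*, §2.1
Prop. 2.19, §3.3 pp. 231–236; Bredon, *Topology and Geometry*, VI.7), two bricks used by the Literature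
home of the discharge of `HodgeTheory.Fulton1998_map_fundamentalClass_fibre_eq`
(`HodgeTheory/SmoothFamilyFibreClassesHolds`):

* `map_localClass_eq_of_isotopy` — **the end of an isotopy through injections has local degree `+1`**: for a
  `ℤ`-orientation `g` of `𝔼 = ℝᵏ`, an open `V ∋ p` and a jointly continuous `H : [0,1] × V → 𝔼` with
  `H(0, ·)` the inclusion and every `H(s, ·)` injective, the map of pairs `H(1, ·) : (V, V ∖ p) → (𝔼, 𝔼 ∖ q)`,
  `q = H(1, p)`, carries the local class `g_p` (excised to `V`) to `g_q`. Proof: `v ↦ H(s, v) - H(s, p) + p`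
  is a homotopy of maps of pairs `(V, V ∖ p) → (𝔼, 𝔼 ∖ p)` from the inclusion (homotopy invariance for pairs,
  the tree's `relativeSingularHomology.map_eq_of_homotopic_holds`), and the translation by `q - p` carries
  `g_p` to `g_q` (`HomologicalOrientation.map_addRight_localClass`).
* `map_localClass_eq_of_transition` — **compatible-charts form of `positiveAtlasOrientation_map_localClass`**:
  for spaces `X'`, `X` with `ℤ`-orientations `μ'`, `μ`, an open partial homeomorphism `e : X' ⇀ X` with
  continuous total function, `x ∈ e.source` with `e` a map of pairs `(X', X' ∖ x) → (X, X ∖ e x)`, and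
  partial homeomorphisms `c' : X' ⇀ 𝔼` at `x`, `c : X ⇀ 𝔼` at `e x` COMPUTING the orientations there
  (`μ'_x = c'^* g_{c' x}`, `μ_y = c^* g_{c y}` on `c.source`): if the transition `c ∘ e ∘ c'⁻¹`, as a map
  of pairs out of `c'(c'.source ∩ e⁻¹ c.source)`, carries the excised `g_{c' x}` to `g_{c (e x)}`, then
  `e_* μ'_x = μ_{e x}`.

Provenance: Literature home of the Summits-side `Theorems/Ring2AbelianAllAndreIsotopyLocalDegree`
(cell Ring 2 · AbelianAll, André axis), which `Literature/` may not import. Lane `lit-hodgefound`, seat p20.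

## References

* [HatcherAT2002] A. Hatcher, Algebraic Topology, CUP 2002, §2.1 Prop. 2.19, §3.3 pp. 231–236.
* [Bredon1993] G. E. Bredon, Topology and Geometry, GTM 139, Springer 1993, VI.7.
-/

noncomputable section

open CategoryTheory Set Filter Topology
open scoped unitInterval
open Literature.AlgebraicTopology.SingularHomology

namespace Literature.AlgebraicTopology.SingularHomology.IsotopyLocalClass

universe u

/-! ## §1 Local degree `+1` at the end of an isotopy through injections -/

section Isotopy

variable {k : ℕ}

/-- **The end of an isotopy through injections has local degree `+1`.** Let `g` be a `ℤ`-orientation of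
`𝔼 = ℝᵏ`, `V ⊆ 𝔼` open, `p ∈ V`, and `H : [0,1] × V → 𝔼` continuous with `H(0, v) = v` and every `H(s, ·)`
injective. Then the map of pairs `H(1, ·) : (V, V ∖ p) → (𝔼, 𝔼 ∖ q)`, `q = H(1, p)`, carries the local
orientation class `g_p` (excised to `V`) to `g_q` (Hatcher, Prop. 2.19 for pairs, §3.3 p. 236: translations
preserve every orientation of `ℝᵏ`). [cite: HatcherAT2002, §2.1 Prop. 2.19 and §3.3 p. 236] -/
theorem map_localClass_eq_of_isotopy (g : HomologicalOrientation ℤ (EuclideanSpace ℝ (Fin k)) k)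
    {V : Set (EuclideanSpace ℝ (Fin k))} (hV : IsOpen V) {p : EuclideanSpace ℝ (Fin k)} (hp : p ∈ V)
    (H : I × ↥V → EuclideanSpace ℝ (Fin k)) (hH : Continuous H) (h0 : ∀ v : ↥V, H (0, v) = v)
    (hinj : ∀ s : I, Function.Injective fun v : ↥V => H (s, v))
    {q : EuclideanSpace ℝ (Fin k)} (hq : H (1, ⟨p, hp⟩) = q)
    (h : MapsTo (fun v : ↥V => H (1, v)) ({(⟨p, hp⟩ : ↥V)}ᶜ : Set ↥V) ({q}ᶜ : Set _)) :
    relativeSingularHomology.map ℤ ℤ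
        (⟨fun v : ↥V => H (1, v), hH.comp (Continuous.prodMk_right 1)⟩ : C(↥V, EuclideanSpace ℝ (Fin k)))
        h k ((localHomology.openSubsetIso ℤ ℤ hV hp k).inv (g.localClass p)) =
      g.localClass q := by
  set p' : ↥V := ⟨p, hp⟩ with hp'
  -- the translated end map `t' v = H(1, v) - q + p` and the translated isotopy
  let t' : C(↥V, EuclideanSpace ℝ (Fin k)) :=
    ⟨fun v : ↥V => H (1, v) + (p - q), (hH.comp (Continuous.prodMk_right 1)).add continuous_const⟩
  let f₀ : C(↥V, EuclideanSpace ℝ (Fin k)) :=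
    ⟨fun v : ↥V => H (0, v) - H (0, p') + p,
      ((hH.comp (Continuous.prodMk_right 0)).sub continuous_const).add continuous_const⟩
  have hf₀ : f₀ = subsetIncl V := by
    ext v : 1
    change H (0, v) - H (0, p') + p = (v : EuclideanSpace ℝ (Fin k))
    rw [h0, h0, hp']
    abel
  have ht'fun : ∀ v : ↥V, t' v = H (1, v) - H (1, p') + p := fun v => by
    change H (1, v) + (p - q) = H (1, v) - H (1, p') + p
    rw [hq]
    abel
  have hmaps : ∀ s : I, MapsTo (fun v : ↥V => H (s, v) - H (s, p') + p) ({p'}ᶜ : Set ↥V)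
      ({p}ᶜ : Set (EuclideanSpace ℝ (Fin k))) := by
    intro s v hv hv'
    apply hv
    rw [mem_singleton_iff] at hv' ⊢
    have h2 : H (s, v) - H (s, p') + p = p := hv'
    have h3 : H (s, v) - H (s, p') = 0 := by rwa [add_eq_right] at h2
    exact hinj s (sub_eq_zero.1 h3)
  have h₀ : MapsTo f₀ ({p'}ᶜ : Set ↥V) ({p}ᶜ : Set (EuclideanSpace ℝ (Fin k))) := hmaps 0
  have h₁ : MapsTo t' ({p'}ᶜ : Set ↥V) ({p}ᶜ : Set (EuclideanSpace ℝ (Fin k))) := by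
    intro v hv
    have := hmaps 1 hv
    change H (1, v) + (p - q) ∈ ({p}ᶜ : Set (EuclideanSpace ℝ (Fin k)))
    rw [show H (1, v) + (p - q) = H (1, v) - H (1, p') + p by rw [hq]; abel]
    exact this
  -- the homotopy of maps of pairs `(V, V ∖ p) → (𝔼, 𝔼 ∖ p)` from `f₀` (= the inclusion) to `t'`
  let F : ContinuousMap.Homotopy f₀ t' :=
    { toFun := fun sv => H (sv.1, sv.2) - H (sv.1, p') + p
      continuous_toFun :=
        ((hH.comp (continuous_fst.prodMk continuous_snd)).sub
          (hH.comp (continuous_fst.prodMk continuous_const))).add continuous_const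
      map_zero_left := fun v => rfl
      map_one_left := fun v => (ht'fun v).symm }
  have hF : ∀ sv : I × ↥V, sv.2 ∈ ({p'}ᶜ : Set ↥V) → F sv ∈ ({p}ᶜ : Set (EuclideanSpace ℝ (Fin k))) :=
    fun sv hsv => hmaps sv.1 hsv
  have hhom := relativeSingularHomology.map_eq_of_homotopic_holds ℤ ℤ h₀ h₁ F hF k
  -- `f₀ = subsetIncl V`, whose push-forward undoes the excision
  have hincl : relativeSingularHomology.map ℤ ℤ f₀ h₀ k
      ((localHomology.openSubsetIso ℤ ℤ hV hp k).inv (g.localClass p)) = g.localClass p := by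
    rw [relativeSingularHomology.map.congr_simp ℤ ℤ _ _ hf₀ h₀ k]
    change ((localHomology.openSubsetIso ℤ ℤ hV hp k).inv ≫
      (localHomology.openSubsetIso ℤ ℤ hV hp k).hom) (g.localClass p) = g.localClass p
    rw [Iso.inv_hom_id, ModuleCat.id_apply]
  -- `H(1, ·) = τ_{q - p} ∘ t'`
  let τ : C(EuclideanSpace ℝ (Fin k), EuclideanSpace ℝ (Fin k)) :=
    ((Homeomorph.addRight (q - p) : EuclideanSpace ℝ (Fin k) ≃ₜ EuclideanSpace ℝ (Fin k)) :
      C(EuclideanSpace ℝ (Fin k), EuclideanSpace ℝ (Fin k)))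
  have hτ : MapsTo τ ({p}ᶜ : Set (EuclideanSpace ℝ (Fin k))) ({q}ᶜ : Set (EuclideanSpace ℝ (Fin k))) :=
    mapsTo_compl_singleton_of_injective (Homeomorph.addRight (q - p)).injective
      (by change p + (q - p) = q; abel)
  have hcomp : (⟨fun v : ↥V => H (1, v), hH.comp (Continuous.prodMk_right 1)⟩ :
      C(↥V, EuclideanSpace ℝ (Fin k))) = τ.comp t' := by
    ext v : 1
    change H (1, v) = H (1, v) + (p - q) + (q - p)
    abel
  rw [relativeSingularHomology.map.congr_simp ℤ ℤ _ _ hcomp h k,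
    relativeSingularHomology.map_comp ℤ ℤ t' τ h₁ hτ k, ModuleCat.comp_apply, ← hhom, hincl]
  exact HomologicalOrientation.map_addRight_localClass g (q - p) p q (by abel)

end Isotopy

/-! ## §2 A local homeomorphism carries the orientation across: compatible-charts form -/

section Transition

variable {k : ℕ} {X' X : Type u} [TopologicalSpace X'] [T2Space X'] [TopologicalSpace X] [T2Space X]

/-- **`e_* μ'_x = μ_{e x}` from compatible charts and a degree-one transition** (the argument of the tree's
`positiveAtlasOrientation_map_localClass`, Bredon VI.7 proof of Thm. 7.15, with the Jacobian replaced by the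
hypothesis that the transition map carries the model class across). Let `μ'`, `μ` be `ℤ`-orientations of
`X'`, `X`, `e : X' ⇀ X` an open partial homeomorphism with continuous total function, `x ∈ e.source`, `e` a
map of pairs `(X', X' ∖ x) → (X, X ∖ e x)`; `c' : X' ⇀ 𝔼` with `x ∈ c'.source` and `μ'_x = c'^* g_{c' x}`;
`c : X ⇀ 𝔼` with `μ_y = c^* g_{c y}` for all `y ∈ c.source` and `e x ∈ c.source`. If the transition
`v ↦ c (e (c'⁻¹ v))` out of the open piece `(c'.restrOpen (e.trans c).source).target`, as a map of pairs,
sends the excised `g_{c' x}` to `g_{c (e x)}`, then `e_* μ'_x = μ_{e x}`.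
[cite: Bredon1993, VI.7] [cite: HatcherAT2002, §3.3 p. 231] -/
theorem map_localClass_eq_of_transition (g : HomologicalOrientation ℤ (EuclideanSpace ℝ (Fin k)) k)
    (μ' : HomologicalOrientation ℤ X' k) (μ : HomologicalOrientation ℤ X k)
    (e : OpenPartialHomeomorph X' X) (hec : Continuous e) {x : X'} (hx : x ∈ e.source)
    (hfib : MapsTo e ({x}ᶜ : Set X') ({e x}ᶜ : Set X))
    (c' : OpenPartialHomeomorph X' (EuclideanSpace ℝ (Fin k))) (hx' : x ∈ c'.source)
    (hμ' : μ'.localClass x = (localHomology.chartXEquiv ℤ ℤ c' hx' k).symm (g.localClass (c' x)))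
    (c : OpenPartialHomeomorph X (EuclideanSpace ℝ (Fin k))) (hxc : e x ∈ c.source)
    (hμ : ∀ (y : X) (hy : y ∈ c.source),
      μ.localClass y = (localHomology.chartXEquiv ℤ ℤ c hy k).symm (g.localClass (c y)))
    (hp : c' x ∈ (c'.restrOpen (e.trans c).source (e.trans c).open_source).target)
    (h : MapsTo (fun v : ↥(c'.restrOpen (e.trans c).source (e.trans c).open_source).target =>
        (e.trans c) (c'.symm v))
      ({(⟨c' x, hp⟩ : ↥(c'.restrOpen (e.trans c).source (e.trans c).open_source).target)}ᶜ)
      ({c (e x)}ᶜ : Set (EuclideanSpace ℝ (Fin k))))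
    (htrans : relativeSingularHomology.map ℤ ℤ
        (⟨fun v : ↥(c'.restrOpen (e.trans c).source (e.trans c).open_source).target =>
            (e.trans c) (c'.symm v),
          ((e.trans c).continuousOn.comp (c'.continuousOn_symm.mono inter_subset_left)
            (fun v (hv : v ∈ c'.target ∩ c'.symm ⁻¹' (e.trans c).source) => hv.2)).restrict⟩ :
          C(↥(c'.restrOpen (e.trans c).source (e.trans c).open_source).target, EuclideanSpace ℝ (Fin k)))
        h k
        ((localHomology.openSubsetIso ℤ ℤ
          (c'.restrOpen (e.trans c).source (e.trans c).open_source).open_target hp k).inv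
          (g.localClass (c' x))) =
      g.localClass (c (e x))) :
    relativeSingularHomology.map ℤ ℤ (⟨e, hec⟩ : C(X', X)) hfib k (μ'.localClass x) =
      μ.localClass (e x) := by
  have hx₂ : x ∈ (e.trans c).source := ⟨hx, hxc⟩
  -- the charts `c'` and `e.trans c` of `X'` at `x` have the same reference class
  have key : (localHomology.chartXEquiv ℤ ℤ c' hx' k).symm (g.localClass (c' x)) =
      (localHomology.chartXEquiv ℤ ℤ (e.trans c) hx₂ k).symm (g.localClass ((e.trans c) x)) := by
    rw [LinearEquiv.eq_symm_apply, chartXEquiv_apply_chartXEquiv_symm (e.trans c) c' hx₂ hx' hp h]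
    exact htrans
  rw [hμ', key, hμ (e x) hxc]
  exact localHomology.map_chartXEquiv_trans_symm e hec c hx₂ hfib k _

end Transition

end Literature.AlgebraicTopology.SingularHomology.IsotopyLocalClass

end
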